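import Summits.CriticalPhenomena.PercolationContinuityZ3.Theorems.SahiTwoDimDensity

/-!
# General (possibly singular) FKG measures on the unit square: `E_n ≥ 0` for semicontinuous monotone families

Companion of `SahiTwoDimDensity.lean` (cell `prim-sahi`, typer, generation 6; `--supports stmt-CriticalPhenomena-4575`).

`SahiTwoDimDensity.lean` proved Sahi's inequalities `E_n ≥ 0` of every order for the ABSOLUTELY CONTINUOUS FKG
probability measures on `[0,1]²` (criterion `mSahiPositive_of_cellWeights`: FKG cell weights on every grid PLUS
`μ ≪ λ`, used to close the Riemann sandwich).  Here the absolute continuity is dropped — the measure `μ` on `[0,1]²`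
may be singular — at the price of a regularity assumption on the FUNCTIONS instead: call `μ` **cell-FKG** if for
every `m` its cell weights `c ↦ μ(cell c)` on the `(m+1) × (m+1)` grid form an FKG (log-supermodular) weight
(`SahiTwoDimDensity.cellWeight`).  Then

* `msahiE_nonneg_of_semicontinuous` — for every `n` and all nonnegative monotone increasing `f_0,…,f_{n−1}` on
  `[0,1]²` EACH OF WHICH IS LOWER OR UPPER SEMICONTINUOUS, `E_n(f_0,…,f_{n−1}) ≥ 0` under `μ`;
* corollaries: continuous monotone families (`msahiE_nonneg_of_continuous`), indicator families of increasing
  events each open or closed (`msahiE_indicator_nonneg_of_isOpen_or_isClosed`);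
* the hypothesis holds for every product probability measure (`isFKGMeasure_cellWeight_prod`) and for every
  absolutely continuous measure with a log-supermodular density (`SahiTwoDimDensity.isFKGMeasure_cellWeight_withDensity`).

Mechanism (no Riemann sandwich, no measurability hypothesis): replace `f_i` by the grid step function
`f_i ∘ c⁻_m ∘ cell_m` if `f_i` is lower semicontinuous and by `f_i ∘ c⁺_m ∘ cell_m` if upper semicontinuous; the
resulting family is a monotone family on the grid under the FKG cell weight, so its `E_n` is `≥ 0` by P1's
two-dimensional theorem `SahiTwoDim.sahiPositive_of_isFKGMeasure_prod` — EXACTLY, for every `m`; and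
`f_i(c^∓_m(cell_m p)) → f_i(p)` for EVERY `p` by semicontinuity (the corners converge to `p` from below / above),
so the joint moments converge by dominated convergence and `E_n` passes to the limit (`continuous_momentE`).
-/

noncomputable section

namespace Summit.CriticalPhenomena.PercolationContinuityZ3.Theorems.SahiTwoDimSemicontinuous

open MeasureTheory Set Filter Topology Finset Literature.Combinatorics.Sahi2008
  Literature.Combinatorics.Sahi2008.LebesgueSquare SahiTwoDimDensity
open scoped unitInterval

variable {m : ℕ}

/-! ## Grid plumbing: the corners of the cell of `p` converge to `p` -/

/-- The coordinate of the grid point `a/N`, `a ≤ N` (plumbing). [this work] -/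
private theorem coe_gridPt_of_le {N a : ℕ} (hN : 0 < N) (h : a ≤ N) : (gridPt N a : ℝ) = (a : ℝ) / N := by
  change min ((a : ℝ) / N) 1 = _
  rw [min_eq_left]
  rw [div_le_one (by exact_mod_cast hN)]
  exact_mod_cast h

/-- Grid points increase with the index (plumbing). [this work] -/
private theorem gridPt_mono (N : ℕ) : Monotone (gridPt N) := by
  intro a b hab
  change min ((a : ℝ) / N) 1 ≤ min ((b : ℝ) / N) 1
  exact min_le_min_right _ (div_le_div_of_nonneg_right (by exact_mod_cast hab) (Nat.cast_nonneg N))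

/-- Consecutive grid points are `1/(m+1)` apart (for indices `≤ m`) (plumbing). [this work] -/
private theorem coe_gridPt_succ_sub (k : Fin (m + 1)) :
    (gridPt (m + 1) ((k : ℕ) + 1) : ℝ) - gridPt (m + 1) k = 1 / ((m : ℝ) + 1) := by
  rw [coe_gridPt_of_le (Nat.succ_pos m) (Nat.succ_le_of_lt k.2), coe_gridPt_of_le (Nat.succ_pos m) k.2.le]
  push_cast
  field_simp
  ring

/-- The lower corner of the cell of `x` is within `1/(m+1)` below `x` (plumbing). [this work] -/
private theorem coe_sub_le_lo (x : I) : (x : ℝ) - 1 / ((m : ℝ) + 1) ≤ (gridPt (m + 1) (cellIdx m x) : ℝ) := by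
  have h1 : (x : ℝ) ≤ gridPt (m + 1) ((cellIdx m x : ℕ) + 1) :=
    Subtype.coe_le_coe.2 (le_hiCorner (m := m) (x, x)).1
  have h2 := coe_gridPt_succ_sub (m := m) (cellIdx m x)
  linarith

/-- The upper corner of the cell of `x` is within `1/(m+1)` above `x` (plumbing). [this work] -/
private theorem hi_le_coe_add (x : I) : (gridPt (m + 1) ((cellIdx m x : ℕ) + 1) : ℝ) ≤ x + 1 / ((m : ℝ) + 1) := by
  have h1 : (gridPt (m + 1) (cellIdx m x) : ℝ) ≤ x := Subtype.coe_le_coe.2 (loCorner_le (m := m) (x, x)).1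
  have h2 := coe_gridPt_succ_sub (m := m) (cellIdx m x)
  linarith

/-- The mesh `1/(m+1) → 0` (plumbing). [this work] -/
private theorem tendsto_inv_succ : Tendsto (fun m : ℕ => (1 : ℝ) / ((m : ℝ) + 1)) atTop (𝓝 0) := by
  have h := (tendsto_const_div_atTop_nhds_zero_nat (1 : ℝ)).comp (tendsto_add_atTop_nat 1)
  refine h.congr fun m => ?_
  simp only [Function.comp_apply, Nat.cast_add, Nat.cast_one]

/-- The lower corner of the cell of `x ∈ [0,1]` tends to `x` as the mesh goes to `0` (plumbing). [this work] -/
private theorem tendsto_lo_coord (x : I) :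
    Tendsto (fun m : ℕ => gridPt (m + 1) (cellIdx m x)) atTop (𝓝 x) := by
  rw [tendsto_subtype_rng]
  have hlo : Tendsto (fun m : ℕ => (x : ℝ) - 1 / ((m : ℝ) + 1)) atTop (𝓝 (x : ℝ)) := by
    simpa using (tendsto_const_nhds (x := (x : ℝ))).sub tendsto_inv_succ
  refine tendsto_of_tendsto_of_tendsto_of_le_of_le hlo tendsto_const_nhds (fun m => coe_sub_le_lo x)
    fun m => ?_
  exact Subtype.coe_le_coe.2 (loCorner_le (m := m) (x, x)).1

/-- The upper corner of the cell of `x ∈ [0,1]` tends to `x` (plumbing). [this work] -/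
private theorem tendsto_hi_coord (x : I) :
    Tendsto (fun m : ℕ => gridPt (m + 1) ((cellIdx m x : ℕ) + 1)) atTop (𝓝 x) := by
  rw [tendsto_subtype_rng]
  have hhi : Tendsto (fun m : ℕ => (x : ℝ) + 1 / ((m : ℝ) + 1)) atTop (𝓝 (x : ℝ)) := by
    simpa using (tendsto_const_nhds (x := (x : ℝ))).add tendsto_inv_succ
  refine tendsto_of_tendsto_of_tendsto_of_le_of_le tendsto_const_nhds hhi (fun m => ?_) fun m => hi_le_coe_add x
  exact Subtype.coe_le_coe.2 (le_hiCorner (m := m) (x, x)).1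

/-- **The lower corners `c⁻_m(cell_m p)` converge to `p`.** [this work] -/
theorem tendsto_loCorner_cellPair (p : I × I) : Tendsto (fun m : ℕ => loCorner m (cellPair m p)) atTop (𝓝 p) :=
  (tendsto_lo_coord p.1).prodMk_nhds (tendsto_lo_coord p.2)

/-- **The upper corners `c⁺_m(cell_m p)` converge to `p`.** [this work] -/
theorem tendsto_hiCorner_cellPair (p : I × I) : Tendsto (fun m : ℕ => hiCorner m (cellPair m p)) atTop (𝓝 p) :=
  (tendsto_hi_coord p.1).prodMk_nhds (tendsto_hi_coord p.2)

/-- The upper-corner map is monotone in the cell. [this work] -/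
theorem monotone_hiCorner (m : ℕ) : Monotone (hiCorner m) := fun _ _ h =>
  ⟨gridPt_mono _ (Nat.succ_le_succ h.1), gridPt_mono _ (Nat.succ_le_succ h.2)⟩

/-! ## Semicontinuous monotone functions along the corners -/

/-- **A lower semicontinuous monotone function is recovered from below along the grid**:
`f(c⁻_m(cell_m p)) → f(p)` for every `p`. [this work] -/
theorem tendsto_comp_loCorner_of_lowerSemicontinuous {f : I × I → ℝ} (hf : Monotone f)
    (hsc : LowerSemicontinuous f) (p : I × I) :
    Tendsto (fun m : ℕ => f (loCorner m (cellPair m p))) atTop (𝓝 (f p)) := by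
  rw [tendsto_order]
  refine ⟨fun y hy => ?_, fun y hy => Eventually.of_forall fun m => lt_of_le_of_lt (hf (loCorner_le p)) hy⟩
  exact (tendsto_loCorner_cellPair p).eventually (lowerSemicontinuousAt_iff.1 (hsc p) y hy)

/-- **An upper semicontinuous monotone function is recovered from above along the grid**:
`f(c⁺_m(cell_m p)) → f(p)` for every `p`. [this work] -/
theorem tendsto_comp_hiCorner_of_upperSemicontinuous {f : I × I → ℝ} (hf : Monotone f)
    (hsc : UpperSemicontinuous f) (p : I × I) :
    Tendsto (fun m : ℕ => f (hiCorner m (cellPair m p))) atTop (𝓝 (f p)) := by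
  rw [tendsto_order]
  refine ⟨fun y hy => Eventually.of_forall fun m => lt_of_lt_of_le hy (hf (le_hiCorner p)), fun y hy => ?_⟩
  exact (tendsto_hiCorner_cellPair p).eventually (upperSemicontinuousAt_iff.1 (hsc p) y hy)

/-! ## The theorem -/

variable {n : ℕ}

/-- **Sahi's inequalities for cell-FKG measures on the unit square, semicontinuous families.**  Let `μ` be a
probability measure on `[0,1]²` whose cell weights on every `(m+1) × (m+1)` grid form an FKG weight.  Then for
every `n` and all nonnegative monotone increasing `f_0,…,f_{n−1} : [0,1]² → ℝ`, each lower OR upper semicontinuous,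
`E_n(f_0,…,f_{n−1}) ≥ 0` under `μ`.  (No absolute continuity, no measurability hypothesis.) [this work] -/
theorem msahiE_nonneg_of_semicontinuous (μ : Measure (I × I)) [IsProbabilityMeasure μ]
    (hFKG : ∀ m, IsFKGMeasure (cellWeight μ m)) (n : ℕ) (f : Fin n → I × I → ℝ) (hf0 : ∀ i p, 0 ≤ f i p)
    (hmono : ∀ i, Monotone (f i)) (hsc : ∀ i, LowerSemicontinuous (f i) ∨ UpperSemicontinuous (f i)) :
    0 ≤ msahiE μ n f := by
  classical
  -- the corner used for `f_i`: lower if lower semicontinuous, upper otherwise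
  set cr : ∀ (i : Fin n) (m : ℕ), Fin (m + 1) × Fin (m + 1) → I × I := fun i m =>
    if LowerSemicontinuous (f i) then loCorner m else hiCorner m with hcr
  have hcr_mono : ∀ i m, Monotone (cr i m) := by
    intro i m
    by_cases h : LowerSemicontinuous (f i)
    · simp only [hcr, h, if_true]
      exact monotone_loCorner m
    · simp only [hcr, h, if_false]
      exact monotone_hiCorner m
  have hle1 : ∀ x : I, x ≤ 1 := fun x => Subtype.coe_le_coe.1 (by rw [Set.Icc.coe_one]; exact x.2.2)
  have hcr_le : ∀ i m (c : Fin (m + 1) × Fin (m + 1)), cr i m c ≤ ((1 : I), (1 : I)) := fun i m c =>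
    ⟨hle1 _, hle1 _⟩
  have hcr_tendsto : ∀ i p, Tendsto (fun m : ℕ => f i (cr i m (cellPair m p))) atTop (𝓝 (f i p)) := by
    intro i p
    by_cases h : LowerSemicontinuous (f i)
    · simp only [hcr, h, if_true]
      exact tendsto_comp_loCorner_of_lowerSemicontinuous (hmono i) h p
    · simp only [hcr, h, if_false]
      exact tendsto_comp_hiCorner_of_upperSemicontinuous (hmono i) ((hsc i).resolve_left h) p
  -- the grid family of level `m` and the step approximants
  set g : ∀ m : ℕ, Fin n → Fin (m + 1) × Fin (m + 1) → ℝ := fun m i => f i ∘ cr i m with hg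
  have hg0 : ∀ m i c, 0 ≤ g m i c := fun m i c => hf0 i _
  have hgmono : ∀ m i, Monotone (g m i) := fun m i => (hmono i).comp (hcr_mono i m)
  -- joint moments: box moments → moments of `f`
  set M : Finset (Fin n) → ℝ := fun S => ∫ p, (∏ i ∈ S, f i) p ∂μ with hM
  have hmom : ∀ S : Finset (Fin n),
      Tendsto (fun m => ex (cellWeight μ m) (∏ i ∈ S, g m i)) atTop (𝓝 (M S)) := by
    intro S
    have hex : ∀ m, ex (cellWeight μ m) (∏ i ∈ S, g m i) = ∫ p, ∏ i ∈ S, f i (cr i m (cellPair m p)) ∂μ := by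
      intro m
      rw [ex_cellWeight]
      refine integral_congr_ae (Eventually.of_forall fun p => ?_)
      simp only [Finset.prod_apply, hg, Function.comp_apply]
    simp only [hex]
    have hMS : M S = ∫ p, ∏ i ∈ S, f i p ∂μ := by
      simp only [hM, Finset.prod_apply]
    rw [hMS]
    set B : ℝ := ∏ i ∈ S, f i (1, 1) with hB
    refine tendsto_integral_of_dominated_convergence (fun _ => B) (fun m => ?_) (integrable_const B)
      (fun m => Eventually.of_forall fun p => ?_) (Eventually.of_forall fun p => ?_)
    · have hmeas : Measurable fun p : I × I => ∏ i ∈ S, f i (cr i m (cellPair m p)) := by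
        have e : (fun p : I × I => ∏ i ∈ S, f i (cr i m (cellPair m p))) =
            (fun c => ∏ i ∈ S, f i (cr i m c)) ∘ cellPair m := rfl
        rw [e]
        exact (measurable_of_countable _).comp (cellPair_measurable m)
      exact hmeas.aestronglyMeasurable
    · rw [Real.norm_eq_abs, abs_of_nonneg (Finset.prod_nonneg fun i _ => hf0 i _)]
      exact Finset.prod_le_prod (fun i _ => hf0 i _) fun i _ => hmono i (hcr_le i m _)
    · exact tendsto_finsetProd S fun i _ => hcr_tendsto i p
  -- pass to the limit in the moment polynomial
  have hE : msahiE μ n f = momentE n M := msahiE_eq_momentE _ n f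
  have hlim : Tendsto (fun m => momentE n fun S => ex (cellWeight μ m) (∏ i ∈ S, g m i)) atTop
      (𝓝 (momentE n M)) :=
    ((continuous_momentE n).tendsto M).comp (tendsto_pi_nhds.2 hmom)
  have hpos : ∀ m, 0 ≤ momentE n fun S => ex (cellWeight μ m) (∏ i ∈ S, g m i) := by
    intro m
    rw [← sahiE_eq_momentE]
    exact SahiTwoDim.sahiPositive_of_isFKGMeasure_prod (hFKG m) n _ (hg0 m) (hgmono m)
  rw [hE]
  exact ge_of_tendsto' hlim hpos

/-- **Lower semicontinuous families** (e.g. indicators of OPEN increasing events). [this work] -/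
theorem msahiE_nonneg_of_lowerSemicontinuous (μ : Measure (I × I)) [IsProbabilityMeasure μ]
    (hFKG : ∀ m, IsFKGMeasure (cellWeight μ m)) (n : ℕ) (f : Fin n → I × I → ℝ) (hf0 : ∀ i p, 0 ≤ f i p)
    (hmono : ∀ i, Monotone (f i)) (hsc : ∀ i, LowerSemicontinuous (f i)) : 0 ≤ msahiE μ n f :=
  msahiE_nonneg_of_semicontinuous μ hFKG n f hf0 hmono fun i => Or.inl (hsc i)

/-- **Upper semicontinuous families** (e.g. indicators of CLOSED increasing events). [this work] -/
theorem msahiE_nonneg_of_upperSemicontinuous (μ : Measure (I × I)) [IsProbabilityMeasure μ]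
    (hFKG : ∀ m, IsFKGMeasure (cellWeight μ m)) (n : ℕ) (f : Fin n → I × I → ℝ) (hf0 : ∀ i p, 0 ≤ f i p)
    (hmono : ∀ i, Monotone (f i)) (hsc : ∀ i, UpperSemicontinuous (f i)) : 0 ≤ msahiE μ n f :=
  msahiE_nonneg_of_semicontinuous μ hFKG n f hf0 hmono fun i => Or.inr (hsc i)

/-- **Continuous monotone families.** [this work] -/
theorem msahiE_nonneg_of_continuous (μ : Measure (I × I)) [IsProbabilityMeasure μ]
    (hFKG : ∀ m, IsFKGMeasure (cellWeight μ m)) (n : ℕ) (f : Fin n → I × I → ℝ) (hf0 : ∀ i p, 0 ≤ f i p)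
    (hmono : ∀ i, Monotone (f i)) (hcont : ∀ i, Continuous (f i)) : 0 ≤ msahiE μ n f :=
  msahiE_nonneg_of_lowerSemicontinuous μ hFKG n f hf0 hmono fun i => (hcont i).lowerSemicontinuous

/-- **Increasing events, each open or closed**: for up-sets `U_0,…,U_{n−1} ⊆ [0,1]²` each open or closed,
`E_n(1_{U_0},…,1_{U_{n−1}}) ≥ 0` under every cell-FKG probability measure. [this work] -/
theorem msahiE_indicator_nonneg_of_isOpen_or_isClosed (μ : Measure (I × I)) [IsProbabilityMeasure μ]
    (hFKG : ∀ m, IsFKGMeasure (cellWeight μ m)) (n : ℕ) (U : Fin n → Set (I × I))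
    (hU : ∀ i, IsUpperSet (U i)) (hoc : ∀ i, IsOpen (U i) ∨ IsClosed (U i)) :
    0 ≤ msahiE μ n fun i => (U i).indicator fun _ => (1 : ℝ) := by
  refine msahiE_nonneg_of_semicontinuous μ hFKG n _ (fun i p => ?_) (fun i p q hpq => ?_) fun i => ?_
  · exact Set.indicator_nonneg (fun _ _ => zero_le_one) p
  · by_cases hp : p ∈ U i
    · rw [Set.indicator_of_mem hp, Set.indicator_of_mem (hU i hpq hp)]
    · rw [Set.indicator_of_notMem hp]
      exact Set.indicator_nonneg (fun _ _ => zero_le_one) q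
  · rcases hoc i with h | h
    · exact Or.inl (h.lowerSemicontinuous_indicator zero_le_one)
    · exact Or.inr (h.upperSemicontinuous_indicator zero_le_one)

/-! ## Product measures are cell-FKG -/

/-- The cell weights of a product measure are the product of the one-dimensional cell masses (plumbing).
[this work] -/
private theorem cellWeight_prod (μ₁ μ₂ : Measure I) [IsProbabilityMeasure μ₁] [IsProbabilityMeasure μ₂]
    (c : Fin (m + 1) × Fin (m + 1)) :
    cellWeight (μ₁.prod μ₂) m c = μ₁.real (cellIdx m ⁻¹' {c.1}) * μ₂.real (cellIdx m ⁻¹' {c.2}) := by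
  have hset : cellPair m ⁻¹' {c} = (cellIdx m ⁻¹' {c.1}) ×ˢ (cellIdx m ⁻¹' {c.2}) := by
    ext p
    simp only [Set.mem_preimage, Set.mem_singleton_iff, Set.mem_prod, cellPair, Prod.ext_iff]
  rw [cellWeight, measureReal_def, hset, Measure.prod_prod, ENNReal.toReal_mul, measureReal_def, measureReal_def]

/-- A one-dimensional weight on a chain satisfies the lattice condition with equality (plumbing). [this work] -/
private theorem mul_eq_mul_inf_sup {w : Fin (m + 1) → ℝ} (a b : Fin (m + 1)) :
    w a * w b = w (a ⊓ b) * w (a ⊔ b) := by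
  rcases le_total a b with h | h
  · rw [inf_eq_left.2 h, sup_eq_right.2 h]
  · rw [inf_eq_right.2 h, sup_eq_left.2 h, mul_comm]

/-- **Every product probability measure on the unit square is cell-FKG** (its cell weights are product weights
on the grid, which satisfy the lattice condition with equality). [this work] -/
theorem isFKGMeasure_cellWeight_prod (μ₁ μ₂ : Measure I) [IsProbabilityMeasure μ₁] [IsProbabilityMeasure μ₂]
    (m : ℕ) : IsFKGMeasure (cellWeight (μ₁.prod μ₂) m) where
  nonneg c := cellWeight_nonneg _ c
  sum_eq_one := sum_cellWeight _
  mul_le_mul c d := by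
    show cellWeight (μ₁.prod μ₂) m c * cellWeight (μ₁.prod μ₂) m d ≤
      cellWeight (μ₁.prod μ₂) m (c.1 ⊓ d.1, c.2 ⊓ d.2) * cellWeight (μ₁.prod μ₂) m (c.1 ⊔ d.1, c.2 ⊔ d.2)
    rw [cellWeight_prod, cellWeight_prod, cellWeight_prod, cellWeight_prod]
    have h1 := mul_eq_mul_inf_sup (w := fun k => μ₁.real (cellIdx m ⁻¹' {k})) c.1 d.1
    have h2 := mul_eq_mul_inf_sup (w := fun k => μ₂.real (cellIdx m ⁻¹' {k})) c.2 d.2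
    refine le_of_eq ?_
    calc μ₁.real (cellIdx m ⁻¹' {c.1}) * μ₂.real (cellIdx m ⁻¹' {c.2}) *
          (μ₁.real (cellIdx m ⁻¹' {d.1}) * μ₂.real (cellIdx m ⁻¹' {d.2}))
        = (μ₁.real (cellIdx m ⁻¹' {c.1}) * μ₁.real (cellIdx m ⁻¹' {d.1})) *
            (μ₂.real (cellIdx m ⁻¹' {c.2}) * μ₂.real (cellIdx m ⁻¹' {d.2})) := by ring
      _ = (μ₁.real (cellIdx m ⁻¹' {c.1 ⊓ d.1}) * μ₁.real (cellIdx m ⁻¹' {c.1 ⊔ d.1})) *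
            (μ₂.real (cellIdx m ⁻¹' {c.2 ⊓ d.2}) * μ₂.real (cellIdx m ⁻¹' {c.2 ⊔ d.2})) := by rw [h1, h2]
      _ = _ := by ring

/-- **Product measures, semicontinuous families** (an instance of the criterion; the product case in fact holds
for all measurable families by the quantile transform, `msahiE_prod_nonneg_of_monotone` in
`SahiLiebSahiContinuumProduct.lean`). [this work] -/
theorem msahiE_prod_nonneg_of_semicontinuous (μ₁ μ₂ : Measure I) [IsProbabilityMeasure μ₁]
    [IsProbabilityMeasure μ₂] (n : ℕ) (f : Fin n → I × I → ℝ) (hf0 : ∀ i p, 0 ≤ f i p)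
    (hmono : ∀ i, Monotone (f i)) (hsc : ∀ i, LowerSemicontinuous (f i) ∨ UpperSemicontinuous (f i)) :
    0 ≤ msahiE (μ₁.prod μ₂) n f :=
  msahiE_nonneg_of_semicontinuous _ (isFKGMeasure_cellWeight_prod μ₁ μ₂) n f hf0 hmono hsc

/-- **Absolutely continuous FKG measures, semicontinuous families** (the cell weights of a log-supermodular
density are FKG, `isFKGMeasure_cellWeight_withDensity`; for such measures all families are covered already by
`mSahiPositive_withDensity'` — recorded to exhibit the criterion's scope). [this work] -/
theorem msahiE_withDensity_nonneg_of_semicontinuous (ρ : I × I → ENNReal) (hρm : Measurable ρ)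
    (hρ : ∀ p q, ρ p * ρ q ≤ ρ (p ⊔ q) * ρ (p ⊓ q)) [IsProbabilityMeasure (volume.withDensity ρ)] (n : ℕ)
    (f : Fin n → I × I → ℝ) (hf0 : ∀ i p, 0 ≤ f i p) (hmono : ∀ i, Monotone (f i))
    (hsc : ∀ i, LowerSemicontinuous (f i) ∨ UpperSemicontinuous (f i)) :
    0 ≤ msahiE (volume.withDensity ρ) n f :=
  msahiE_nonneg_of_semicontinuous _ (fun m => isFKGMeasure_cellWeight_withDensity ρ hρm hρ m) n f hf0 hmono hsc

end Summit.CriticalPhenomena.PercolationContinuityZ3.Theorems.SahiTwoDimSemicontinuous
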